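import Summits.HubbardSuperconductivity.HubbardSuperconductivity.Theses.IsoperimetricCascade
import Summits.HubbardSuperconductivity.HubbardSuperconductivity.Theorems.IsoperimetricCascadeGlue
import Summits.HubbardSuperconductivity.HubbardSuperconductivity.Theorems.IsoperimetricCascadeCascadeToFloor

/-!
# Route `IsoperimetricCascade` — assembly item `Assembly` (stmt-HubbardSuperconductivity-15153)

`IsoperimetricCascade.Assembly` was RESTATED by the route-repair planner on 2026-08-16 (rev after
09:03Z) to the route's mathematical assembly
`FlatAGPNormGrowth → IsoperimetricInequality → OverlapRate → HubbardSuperconductivity`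
(Coleman's geminal-power norm growth plus the two cruxes give the summit), replacing the earlier
six-binder pure-logic form (stmt-HubbardSuperconductivity-11989, proved in the previous revision of
this file by the term `IsoperimetricCascade.closes`). With the three glue supports landed —
`cruxesGiveCascade_proof` and `floorToSummit_proof` (`Theorems/IsoperimetricCascadeGlue.lean`),
`cascadeToFloor_proof` (`Theorems/IsoperimetricCascadeCascadeToFloor.lean`) — the restated assembly
is their composition `FloorToSummit ∘ CascadeToFloor ∘ CruxesGiveCascade`. This revision keeps the
declaration name `isoperimetricCascade_assembly_proof` (referenced by the ledger) and replaces its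
proof; the statement is, by name, the route decl `IsoperimetricCascade.Assembly` in its current
meaning. Sources: A. J. Coleman, J. Math. Phys. 6 (1965) 1425; D. J. Scalapino, Phys. Rep. 250
(1995) 329, §2. No new definitions.
-/

-- the mandated namespace `Summit.<Summit>.<Problem>.Theorems` repeats `HubbardSuperconductivity`
-- (single-problem summit, D-0017), which the `dupNamespace` linter flags on every declaration
set_option linter.dupNamespace false

namespace Summit.HubbardSuperconductivity.HubbardSuperconductivity.Theorems

/-- **Assembly of route `IsoperimetricCascade`** (item `stmt-HubbardSuperconductivity-15153`):
`FlatAGPNormGrowth → IsoperimetricInequality → OverlapRate → HubbardSuperconductivity`, the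
composition of the landed glue: the two cruxes give the cascade criterion with the overlap rate
(`cruxesGiveCascade_proof`), the norm growth turns the cascade into the every-ground-state `L⁴`
pair-field floor (`cascadeToFloor_proof`), and the floor gives the summit (`floorToSummit_proof`).
[folklore] -/
theorem isoperimetricCascade_assembly_proof :
    Summit.HubbardSuperconductivity.HubbardSuperconductivity.Theses.IsoperimetricCascade.Assembly :=
  fun hGrowth hIso hOverlap =>
    floorToSummit_proof (cascadeToFloor_proof hGrowth (cruxesGiveCascade_proof hIso hOverlap))

end Summit.HubbardSuperconductivity.HubbardSuperconductivity.Theorems
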